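import Summits.QuantumFields.BalabanUV.T4Continuum.Support.NE7PcTDivergenceSupOfEinv
import Summits.QuantumFields.BalabanUV.T4Continuum.Support.NE7EnergySliceSupFlatOfPcT
import Summits.QuantumFields.BalabanUV.Beta.GAN24.KcompInverseUniform
import HarnessLib

/-!
# NE7PcTDivergenceSup — INTERFACE REQUEST NE7 G99-IR1′ (E-INV) ANSWERED BY NAME, hence IR1 (the sup letter `‖PcT·∂ᴴ g‖_∞ ≤ C‖g‖_∞` for Bałaban's (1.26)
# projection) and the FLAT energy-slice sup letter of `𝒯_E(1)` are UNCONDITIONAL theorems on every cubic torus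

Cell `pub-balaban`, sub-cell t4; written by the row-NE7b OWNER lineage `b2b-balaban-t4-ne7b-p1` (gen 149) for the sibling crux row NE7 (lineage `t4-ne7-p1`,
gen 99's INTERFACE REQUEST G99-IR1′, `HOME/INBOX.md` 2026-08-30T04:30Z: «WANTED: `theorem exists_sup_E_inv (d) {a'} (ha' : 0 < a') : ∃ σ > 0, ∀ n [NeZero n]
(M) [∀ μ, NeZero (M μ)] (v b), (∀ y, ‖v y‖ ≤ b) → ∀ y, ‖((QsOp n M * Gps n M a' * Gps n M a' * blkInj n M)⁻¹ *ᵥ v) y‖ ≤ σ * b`»).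

THE OBSERVATION.  The biharmonic block form `E := Q′𝒢′𝒢′Q′*` of `NE7PcTDivergenceSupOfEinv` (with Bałaban's weighted adjoint `Q′* = blkInj = n^d·Q′ᴴ`,
`HardMinimiserOneStepSup.blkInj_eq_smul`) IS, on the nose, NE2's compressed unit-lattice operator `ScalarAveragedCompression.Kcomp n M a′ = n^d•(Q′𝒢′𝒢′Q′ᴴ)`
(`E_eq_Kcomp`: one rewrite), and the G-an2-4 swarm ALREADY PROVED the requested estimate for `Kcomp` on EVERY torus:
`Beta.GAN24.KcompInverseUniform.kcomp_inv_sup` ∕ `kcomp_inv_decay` (gan24-formalise-leaf-01 gen 56; Combes–Thomas on the unit torus from the (L0) letter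
`rowDecay_Gps`, the uniform coercivity `form_Kcomp_ge` and the small-rate cosh budget).  So (E-INV) needs no new analysis — only this junction.

WHAT ([folklore]; 0 def, 0 sorry; junction only — every estimate is a TREE theorem BY NAME):
§1 `E_eq_Kcomp` (`QsOp·Gps·Gps·blkInj = Kcomp`, every torus `M : Fin d → ℕ`).
§2 **`exists_sup_E_inv`** — (E-INV) VERBATIM as requested, every torus `M : Fin (d+1) → ℕ`, every `n ≥ 1`, every `a′ > 0` (`σ` a function of `(d, a′)` chosen before
   `n`, `M`); **`exists_decay_E_inv`** — the kernel form `‖E⁻¹(y,y′)‖ ≤ σ·e^{−δ·|rep y − rep y′|_{T,∞}}`; **`e_inv_sup_cubic`** — the cubic-torus shape that is LITERALLY the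
   hypothesis `hE` of `NE7PcTDivergenceSupOfEinv.pcT_gradOpH_sup_of_Einv` (`M = fun _ ⇒ N₀`, `a′ = 1`, with the idle `1 ≤ n →`).
§3 **`pcT_gradOpH_sup`** — IR1 UNCONDITIONAL: `∃ C > 0, ∀ n N₀ ≥ 1, ∀ g b, ‖g‖_∞ ≤ b → ∀ y, ‖(PcT n M n·(GradOp (fine n M) n)ᴴ g)(y)‖ ≤ C·b` on cubic tori
   (`pcT_gradOpH_sup_of_Einv` with `hE` discharged by §2).
§4 **`energySlice_sup_flat`** — THE FLAT `𝒯_E(1)` SUP LETTER UNCONDITIONAL: `NE7EnergySliceSupFlatOfPcT.energySlice_sup_of_pcT_letter` with its one displayed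
   row `hP` (= IR1) discharged by §3: `∃ K > 0` such that for every `n ≥ 1`, every cubic torus, every `x` with `Q_k x = 0` and `∂ᴴx ∈ range Q′*`, and every bound
   `B` of the plaquette field `Fs`, `‖x i‖ ≤ K·B`.
HONEST FRAMING (page 1).  A JUNCTION: nothing new is estimated here; the analysis is the G-an2-4 swarm's (`KcompInverseUniform`, constants existential in
`(d, a′)`, n- and volume-uniform) and row NE7's (`NE7PcTDivergenceSupOfEinv`, `NE7EnergySliceSupFlatOfPcT`, `NE7LandauLinearSup`, `NE7SharpConstrainedGradientRow`).
Effect BY NAME on row NE7's road of record (memo `t4/b2b-balaban-t4-ne7-p1-g99/ROAD-G99.md` §3.8–§3.9): the item «(L-flat) (E-INV)» is CLOSED — the flat half of THE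
LETTER is a theorem; what remains there is (S1) the nonlinear slice theorem for `𝒯_E`, (S2) the DL letters, the curved bootstrap §3.7 and the numeric k-free line.
`U = 1`, scalar, flat, linear; NOT the curved letter, NOT the supplier, NOT NE7, NOT NE7b; spine 0∕9; finite T⁴ rung (B)+1 — NOT infinite volume, NOT mass gap,
NOT BetaPertH, NOT Clay.  [B5] (1.26) p. 22 ∕ p. 38 (1.126) are TEXT LOCATIONS; nothing printed is asserted.  HONEST DEPENDENCY: continuum YM on T⁴ ⇐ BetaPertH ∧
nine spine estimates (0/9 proved); BetaPertH ⇐ (D1) ∧ (D4) ∧ CAP+tail; G-an2-4 gates asym, D1 and NE2/3/4.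
-/

set_option autoImplicit false

open scoped BigOperators Matrix ComplexConjugate

namespace Summit.QuantumFields.BalabanUV.T4Continuum.NE7PcTDivergenceSup

open Literature.MathematicalPhysics.QuantumFieldTheory.Balaban1983to89
open B5Prop11Plancherel (Tor fine)
open B5Action121 (Fs GradOp)
open B5Block118 (QsOp QvOp)
open B5Value126 (PcT)
open B4TorusKernel.MultiPeriod (torusSupNorm)
open B6LowerBound2153Torus (rep)
open Summit.QuantumFields.BalabanUV.T4Continuum.ScalarAveragedPropagator (Gps)
open Summit.QuantumFields.BalabanUV.T4Continuum.ScalarAveragedCompression (Kcomp)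
open Summit.QuantumFields.BalabanUV.Beta.GAN24.SoftMinimiserOneStepSup (blkInj)
open Summit.QuantumFields.BalabanUV.Beta.GAN24.HardMinimiserOneStepSup (blkInj_eq_smul)
open Summit.QuantumFields.BalabanUV.Beta.GAN24.KcompInverseUniform (kcomp_inv_sup kcomp_inv_decay)
open NE7PcTDivergenceSupOfEinv (pcT_gradOpH_sup_of_Einv)
open NE7EnergySliceSupFlatOfPcT (energySlice_sup_of_pcT_letter)

noncomputable section

/-! ## §1 `E = Kcomp` -/

section Identification

variable {d : ℕ} (n : ℕ) [NeZero n] (M : Fin d → ℕ) [∀ μ, NeZero (M μ)]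

/-- **`E = Kcomp`**: the biharmonic block form `Q′𝒢′𝒢′Q′*` (weighted adjoint `Q′* = n^d·Q′ᴴ`) is NE2's compressed operator `n^d•(Q′𝒢′𝒢′Q′ᴴ)`, every torus. [folklore] -/
theorem E_eq_Kcomp (a' : ℝ) : QsOp n M * Gps n M a' * Gps n M a' * blkInj n M = Kcomp n M a' := by
  rw [Kcomp, blkInj_eq_smul, Matrix.mul_smul]

end Identification

/-! ## §2 (E-INV): the inverse biharmonic block form is uniformly sup-bounded and exponentially localised -/

/-- **(E-INV), SUP FORM, EVERY TORUS** (INTERFACE REQUEST NE7 G99-IR1′ verbatim): for every `a′ > 0` ONE `σ > 0` (a function of `(d, a′)`, chosen before `n` and the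
torus) with `‖v‖_∞ ≤ b ⟹ ‖((Q′𝒢′𝒢′Q′*)⁻¹ v)(y)‖ ≤ σ·b` for every `n ≥ 1` and every torus `M : Fin (d+1) → ℕ` — `KcompInverseUniform.kcomp_inv_sup` BY NAME through
`E_eq_Kcomp`. [folklore] -/
theorem exists_sup_E_inv (d : ℕ) {a' : ℝ} (ha' : 0 < a') :
    ∃ σ : ℝ, 0 < σ ∧ ∀ (n : ℕ) [NeZero n] (M : Fin (d + 1) → ℕ) [∀ μ, NeZero (M μ)] (v : Tor M → ℂ) (b : ℝ),
      (∀ y, ‖v y‖ ≤ b) → ∀ y, ‖((QsOp n M * Gps n M a' * Gps n M a' * blkInj n M)⁻¹ *ᵥ v) y‖ ≤ σ * b := by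
  obtain ⟨S, hS, h⟩ := kcomp_inv_sup d ha'
  refine ⟨S, hS, fun n _ M _ v b hv y => ?_⟩
  rw [E_eq_Kcomp]
  exact h n M v b hv y

/-- **(E-INV), KERNEL FORM, EVERY TORUS**: `σ, δ > 0` (functions of `(d, a′)`) with `‖(Q′𝒢′𝒢′Q′*)⁻¹(y, y′)‖ ≤ σ·e^{−δ·|rep y − rep y′|_{T,∞}}` for every `n ≥ 1`
and every torus — `KcompInverseUniform.kcomp_inv_decay` BY NAME. [folklore] -/
theorem exists_decay_E_inv (d : ℕ) {a' : ℝ} (ha' : 0 < a') :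
    ∃ σ δ : ℝ, 0 < σ ∧ 0 < δ ∧ ∀ (n : ℕ) [NeZero n] (M : Fin (d + 1) → ℕ) [∀ μ, NeZero (M μ)] (y y' : Tor M),
      ‖(QsOp n M * Gps n M a' * Gps n M a' * blkInj n M)⁻¹ y y'‖ ≤ σ * Real.exp (-(δ * torusSupNorm M (rep M y - rep M y'))) := by
  obtain ⟨σ, δ, hσ, hδ, h⟩ := kcomp_inv_decay d ha'
  refine ⟨σ, δ, hσ, hδ, fun n _ M _ y y' => ?_⟩
  rw [E_eq_Kcomp]
  exact h n M y y'

/-- **(E-INV) IN THE CONSUMER'S CUBIC SHAPE**: literally the hypothesis `hE` of `NE7PcTDivergenceSupOfEinv.pcT_gradOpH_sup_of_Einv` at any `a′ > 0`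
(cubic tori `M = fun _ ⇒ N₀`; the binder `1 ≤ n` is idle). [folklore] -/
theorem e_inv_sup_cubic (d : ℕ) {a' : ℝ} (ha' : 0 < a') :
    ∃ σ : ℝ, 0 < σ ∧ ∀ (n N₀ : ℕ) [NeZero n] [NeZero N₀], 1 ≤ n →
      ∀ (v : Tor (fun _ : Fin (d + 1) => N₀) → ℂ) (b : ℝ), (∀ y, ‖v y‖ ≤ b) →
        ∀ y, ‖((QsOp n (fun _ : Fin (d + 1) => N₀) * Gps n (fun _ : Fin (d + 1) => N₀) a' * Gps n (fun _ : Fin (d + 1) => N₀) a'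
              * blkInj n (fun _ : Fin (d + 1) => N₀))⁻¹ *ᵥ v) y‖ ≤ σ * b := by
  obtain ⟨σ, hσ, h⟩ := exists_sup_E_inv d ha'
  exact ⟨σ, hσ, fun n N₀ _ _ _ v b hv y => h n (fun _ => N₀) v b hv y⟩

/-! ## §3 IR1 unconditional -/

/-- **IR1 — THE `PcT·∂ᴴ` SUP LETTER, UNCONDITIONAL** (INTERFACE REQUEST NE7 G99-IR1 as a theorem): `∃ C > 0` such that for every `n ≥ 1`, every cubic torus
`fun _ ⇒ N₀` and every vector field `g` with `‖g‖_∞ ≤ b`, `‖(PcT n M n · (GradOp (fine n M) n)ᴴ g)(y)‖ ≤ C·b` for all `y` — `pcT_gradOpH_sup_of_Einv` with its one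
displayed hypothesis (E-INV) discharged by `e_inv_sup_cubic` at `a′ = 1`. [folklore] -/
theorem pcT_gradOpH_sup (d : ℕ) :
    ∃ C : ℝ, 0 < C ∧ ∀ (n N₀ : ℕ) [NeZero n] [NeZero N₀], 1 ≤ n →
      ∀ (g : Tor (fine n (fun _ : Fin (d + 1) => N₀)) × Fin (d + 1) → ℂ) (b : ℝ), (∀ i, ‖g i‖ ≤ b) →
        ∀ y, ‖(PcT n (fun _ : Fin (d + 1) => N₀) (n : ℂ) *ᵥ ((GradOp (fine n (fun _ : Fin (d + 1) => N₀)) (n : ℂ))ᴴ *ᵥ g)) y‖ ≤ C * b := by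
  obtain ⟨σ, _, hE⟩ := e_inv_sup_cubic d one_pos
  exact pcT_gradOpH_sup_of_Einv d hE

/-! ## §4 The flat energy-slice sup letter, unconditional -/

/-- **THE FLAT SUP LETTER OF THE CORNER-FREE ENERGY SLICE `𝒯_E(1)`, UNCONDITIONAL**: `∃ K > 0` such that for every `n ≥ 1`, every cubic torus `fun _ ⇒ N₀`,
every `Q_k`-tangent vector field `x` (`QvOp x = 0`) in the energy gauge (`∂ᴴx = Q′*c` for some `c`), and every bound `B` of its plaquette field `Fs`, `‖x i‖ ≤ K·B` for
all bonds `i` — `NE7EnergySliceSupFlatOfPcT.energySlice_sup_of_pcT_letter` with its displayed row `hP` (IR1) discharged by `pcT_gradOpH_sup`. [folklore] -/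
theorem energySlice_sup_flat (d : ℕ) :
    ∃ K : ℝ, 0 < K ∧ ∀ (n N₀ : ℕ) [NeZero n] [NeZero N₀], 1 ≤ n →
      ∀ (x : Tor (fine n (fun _ : Fin (d + 1) => N₀)) × Fin (d + 1) → ℂ), QvOp n (fun _ : Fin (d + 1) => N₀) *ᵥ x = 0 →
        (∃ c : Tor (fun _ : Fin (d + 1) => N₀) → ℂ,
          (GradOp (fine n (fun _ : Fin (d + 1) => N₀)) (n : ℂ))ᴴ *ᵥ x = blkInj n (fun _ : Fin (d + 1) => N₀) *ᵥ c) →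
        ∀ B : ℝ, (∀ (μ ν : Fin (d + 1)) (t : Tor (fine n (fun _ : Fin (d + 1) => N₀))),
            ‖Fs (fine n (fun _ : Fin (d + 1) => N₀)) (n : ℂ) x μ ν t‖ ≤ B) →
          ∀ i, ‖x i‖ ≤ K * B := by
  obtain ⟨C, _, hP⟩ := pcT_gradOpH_sup d
  exact energySlice_sup_of_pcT_letter d hP

end

end Summit.QuantumFields.BalabanUV.T4Continuum.NE7PcTDivergenceSup
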